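/-
Copyright: the b2b-balaban T⁴-continuum CRUX team, row NE7b leaf lineage `t4-ne7b-formalise-leaf-06` (gen 158). Project licence.
-/
import Literature.MathematicalPhysics.QuantumFieldTheory.Balaban1983to89.B5Hk103ScalarZd

/-!
# THE ONE-SHOT SECTION IN THE MIXED CURRENCY `ℓ^∞(coarse) → ℓ^∞(blocks; block-RMS)`: the letter BY NAME for every `d` and every mesh,
# `RMS_{B(y″)}(HB) ≤ c_H·Σ_y|B(y)|e^{−δ_H·dist(y″,y)} ≤ c_H·K_d(δ_H)·‖B‖_∞`, and the SDP-DUAL CERTIFICATE SHAPE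
# `(∀v, Σ_b(Σ_z v_z h_{zb})²∕w_b ≤ λΣ_z v_z²) ⇒ Σ_z(Σ_b h_{zb}B_b)² ≤ λ·Σ_b w_bB_b²` as a theorem, read on `H`: `K_mix(T)² ≤ λ·(Σ_bw_b)∕(n+1)^d`
# (row NE7b, node U5c; PRICING-NE7b v122 F727 (b)(d) — the third currency of the trichotomy; [folklore] over `B5Hk103ScalarZd` BY NAME)

Cell `pub-balaban`, sub-cell `t4`, spine estimate NE7b (`T4WeightBudget.RelWeightBound`; the cell's OWN estimate — NOT PRINTED in
[Bałaban 1983–89], NOT PROVED).  Crux-route work under `Spine/NE7b/` by leaf-06 (CRUX team (2), FREEZE (0) crux-prover clause).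
NOTHING of Bałaban's is named as a Lean object, valued or asserted; no `T4Continuum/Support` leaf typed; no `def`; zero `sorry`.
Import: `Literature.….B5Hk103ScalarZd` ONLY (the scalar one-shot section `H = G′Q′*(Q′G′Q′*)⁻¹` on `ℤ^d` as the kernel `kerH`, its DUAL block
letter `abs_sum_mul_kerH_le`, the constants `cH`, `deltaH`, and `B4Sect5Proof.latticeSum_le`).

WHY.  The pricing desk's v122 F727 corrects NL-NE7b-1 to NL-NE7b-1′ and prices a TRICHOTOMY of currencies for the chart constant of the
one-shot section (d = 4): η-`ℓ²` BY PROOF at every `M` (the OWNER's (42)∕(44)∕(45), leaf-03's OSFU); SUP by proof for `M ≥ M₀` existential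
((46)) and by value only from `M = 4`; and the MIXED currency `ℓ^∞(coarse) → ℓ^∞(blocks; block-RMS)` — coarse domain a polydisc like
print's, fine ball volume-uniform — in which the letter HOLDS BY VALUE AT EVERY `M ≥ 2` (instrument 12: `1.21 ≤ K_mix(2) ≤ 1.33 < 2`,
`K_mix(3) ≤ 1.60 < 3`, `K_mix(4) ≤ 1.71`), «UNPROVED, certificate shape offered (NC-NE7b-γ)».  THIS FILE types that currency: (§2–§3) the
mixed letter BY NAME for EVERY `d` and every mesh, from the tree's DUAL block letter `|Σ_{p∈B(y″)}v_pH(p,y)| ≤ c_H√((n+1)^d)e^{−δ_H dist(y″,y)}‖v‖₂`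
by the self-duality trick `S ≤ A√S ⇒ √S ≤ A` (test vector `v := (HB)|_{B(y″)}`), constants the tree's explicit `cH ∕ deltaH` (by value the
`10^{366}` family: EMPTY — smallness at `M = 2, 3` is a cancellation effect no absolute-sum proof sees, F727 (d)); and (§4–§5) the desk's
SDP-DUAL CERTIFICATE SHAPE U2 as a theorem, so that a balaban-calc certificate `(w, λ)` at fixed `(d, M, R)` — one certified top eigenvalue of
`Σ_b h(b)h(b)ᵀ∕w_b` — becomes a kernel inequality BY SUBSTITUTION (a certified `λ` entering as the displayed hypothesis `hdual` on the NAMED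
kernel entries `kerH n a p y`, with `T` the polydisc window in §5's `Finset` form).  RELATION TO THE TREE (by name): the same block-RMS decay is
`B5Hk103ScalarZd.kerH_blockRMS_le` (`((n+1)^{−d}Σ_{p∈B(y″)}H(p,y)²)^{1∕2} ≤ c_He^{−δ_H dist(y″,y)}`, one column), and `B5HkUniformL2Zd` §2–§3
(`blockNorm_le`, `sum_block_HBZd_sq_le`, `tsum_blockNorm_row_le`) carry the weighted block letter for square-summable `B` in `tsum` currency by
Minkowski; THIS FILE's §2–§3 are the FINITE-WINDOW, bounded-`B` (polydisc) form by duality, with the constant DISPLAYED as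
`cH d a * latticeConst d (deltaH d a)` — the shape against which the OWNER's sup letter (46) (`K_mix ≤ ‖H‖_{∞→∞}`) and the desk's NC-NE7b-γ
certificate both read (OWNER ruling W-ne7bp1-g113-3: the hard-step cell's radius letter is read, of record, in THIS currency).

WHAT IS PROVED (`a > 0`, `kerH n a p y` the section's kernel, `B n y″` the block of side `n+1` at `y″`, finite coarse windows `T`; all [folklore]):
* §2 `sum_sq_HB_le` (`Σ_{p∈B(y″)}(Σ_{y∈T}H(p,y)B(y))² ≤ (c_H√((n+1)^d)·Σ_{y∈T}|B(y)|e^{−δ_H dist(y″,y)})²` — duality), **`blockRMS_HB_le_weighted`**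
  (`√((n+1)^{−d}Σ_{p∈B(y″)}(Σ_{y∈T}H(p,y)B(y))²) ≤ c_H·Σ_{y∈T}|B(y)|e^{−δ_H·dist(y″,y)}`).
* §3 **`blockRMS_HB_le_sup`** (`|B| ≤ R` on `T`, `0 ≤ R` ⇒ `… ≤ c_H(d,a)·K_d(δ_H(d,a))·R`) — THE MIXED LETTER `‖H_M‖_{ℓ^∞→ℓ^∞(blocks;RMS)} ≤ c_H·K_d(δ_H)`
  for EVERY `d`, EVERY composite side `M = n + 1`, on finite windows.
* §4 `weighted_cauchy_schwarz` (`(Σ_b x_b y_b)² ≤ (Σ_b w_b x_b²)(Σ_b y_b²∕w_b)`, `w > 0`), **`sdpDual_certificate`** (the U2 shape above, any finite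
  `Z`, `T`, kernel `h`).
* §5 **`sdpDual_certificate_kerH`** (on `Z = B(y″)`, `h = kerH`: the dual hypothesis ⇒ `Σ_{p∈B(y″)}(Σ_{y∈T}H(p,y)B(y))² ≤ λΣ_{y∈T}w_yB(y)²`),
  **`blockRMS_HB_le_of_certificate`** (`|B| ≤ R`, `0 ≤ R`, `0 ≤ λ` ⇒ `√((n+1)^{−d}Σ(HB)²) ≤ √(λ(Σ_yw_y)∕(n+1)^d)·R` — F727 (d)'s
  `K_mix² ≤ λ·(Σw)∕M^d` VERBATIM).

HONEST: the by-name constant of §3 is astronomically large (EMPTY against `M^{(d−2)∕2}` at every `M` of record); §5 carries no number — it is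
the receptacle for NC-NE7b-γ's certificate (not booked by the desk; the fork «which currency (d1) uses» is the OWNER's ∕ leaf-01's, F727 (e)).
`ℤ^d` object; no torus; nothing of (A3) ∕ NC-NE7b-α.  BY-NAME EFFECT ON THE WALL: NONE.  NE7b NOT PRINTED ∕ NOT PROVED; spine PROVED 0∕9;
rung (B)+1 on a FINITE torus — NOT infinite volume, NOT the mass gap, NOT Clay.  HONEST DEPENDENCY: continuum YM on T⁴ ⇐ BetaPertH ∧ nine
spine estimates (0∕9 proved); BetaPertH ⇐ (D1) ∧ (D4) ∧ CAP+tail; G-an2-4 gates asym, D1 and NE2∕3∕4.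
-/

set_option autoImplicit false

namespace Summit.QuantumFields.BalabanUV.T4Continuum.NE7b.OneShotChartMixedNorm

open Finset
open Literature.MathematicalPhysics.QuantumFieldTheory.Balaban1983to89
open B4Sect5Proof (latticeConst latticeSum_le latticeConst_nonneg)
open B6QGQLower276 (X B)
open B5Hk103ScalarZd (kerH cH deltaH cH_pos deltaH_pos abs_sum_mul_kerH_le)

variable {d : ℕ}

/-! ## §1–§2. The mixed letter, weighted form (duality on one block; the self-duality trick `S ≤ A√S ⇒ √S ≤ A` inlined) -/

/-- **DUALITY ON A BLOCK**: `Σ_{p∈B(y″)}(Σ_{y∈T}H(p,y)B(y))²` is at most `(c_H√((n+1)^d)·Σ_{y∈T}|B(y)|e^{−δ_H dist(y″,y)})·√(itself)` — test the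
tree's dual block letter `abs_sum_mul_kerH_le` against `v := (HB)|_{B(y″)}`, column by column. [folklore] -/
theorem sum_sq_HB_le_mul_sqrt (n : ℕ) {a : ℝ} (ha : 0 < a) (y'' : X d) (T : Finset (X d)) (Bf : X d → ℝ) :
    ∑ p ∈ B n y'', (∑ y ∈ T, kerH n a p y * Bf y) ^ 2
      ≤ (cH d a * Real.sqrt (((n : ℝ) + 1) ^ d) * ∑ y ∈ T, |Bf y| * Real.exp (-(deltaH d a * dist y'' y)))
        * Real.sqrt (∑ p ∈ B n y'', (∑ y ∈ T, kerH n a p y * Bf y) ^ 2) := by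
  set F : X d → ℝ := fun p => ∑ y ∈ T, kerH n a p y * Bf y with hF
  have hswap : ∑ p ∈ B n y'', F p ^ 2 = ∑ y ∈ T, Bf y * ∑ p ∈ B n y'', F p * kerH n a p y := by
    calc ∑ p ∈ B n y'', F p ^ 2 = ∑ p ∈ B n y'', ∑ y ∈ T, F p * (kerH n a p y * Bf y) := by
          refine Finset.sum_congr rfl fun p _ => ?_
          rw [sq, hF, Finset.mul_sum]
      _ = ∑ y ∈ T, ∑ p ∈ B n y'', F p * (kerH n a p y * Bf y) := Finset.sum_comm
      _ = ∑ y ∈ T, Bf y * ∑ p ∈ B n y'', F p * kerH n a p y := by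
          refine Finset.sum_congr rfl fun y _ => ?_
          rw [Finset.mul_sum]
          exact Finset.sum_congr rfl fun p _ => by ring
  have hcol : ∀ y ∈ T, Bf y * ∑ p ∈ B n y'', F p * kerH n a p y
      ≤ |Bf y| * (cH d a * Real.sqrt (((n : ℝ) + 1) ^ d) * Real.exp (-(deltaH d a * dist y'' y))
          * Real.sqrt (∑ p ∈ B n y'', F p ^ 2)) := by
    intro y _
    calc Bf y * ∑ p ∈ B n y'', F p * kerH n a p y ≤ |Bf y * ∑ p ∈ B n y'', F p * kerH n a p y| := le_abs_self _
      _ = |Bf y| * |∑ p ∈ B n y'', F p * kerH n a p y| := abs_mul _ _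
      _ ≤ |Bf y| * (cH d a * Real.sqrt (((n : ℝ) + 1) ^ d) * Real.exp (-(deltaH d a * dist y'' y))
          * Real.sqrt (∑ p ∈ B n y'', F p ^ 2)) :=
          mul_le_mul_of_nonneg_left (abs_sum_mul_kerH_le n ha y'' y F) (abs_nonneg _)
  calc ∑ p ∈ B n y'', F p ^ 2 = ∑ y ∈ T, Bf y * ∑ p ∈ B n y'', F p * kerH n a p y := hswap
    _ ≤ ∑ y ∈ T, |Bf y| * (cH d a * Real.sqrt (((n : ℝ) + 1) ^ d) * Real.exp (-(deltaH d a * dist y'' y))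
          * Real.sqrt (∑ p ∈ B n y'', F p ^ 2)) := Finset.sum_le_sum hcol
    _ = (cH d a * Real.sqrt (((n : ℝ) + 1) ^ d) * ∑ y ∈ T, |Bf y| * Real.exp (-(deltaH d a * dist y'' y)))
          * Real.sqrt (∑ p ∈ B n y'', F p ^ 2) := by
        rw [Finset.mul_sum, Finset.sum_mul]
        exact Finset.sum_congr rfl fun y _ => by ring

/-- **THE MIXED LETTER, WEIGHTED FORM**: `√((n+1)^{−d}Σ_{p∈B(y″)}(Σ_{y∈T}H(p,y)B(y))²) ≤ c_H·Σ_{y∈T}|B(y)|·e^{−δ_H·dist(y″,y)}` for EVERY `d`,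
every mesh `n`, every block `y″`, every finite window `T`. [folklore] -/
theorem blockRMS_HB_le_weighted (n : ℕ) {a : ℝ} (ha : 0 < a) (y'' : X d) (T : Finset (X d)) (Bf : X d → ℝ) :
    Real.sqrt ((((n : ℝ) + 1) ^ d)⁻¹ * ∑ p ∈ B n y'', (∑ y ∈ T, kerH n a p y * Bf y) ^ 2)
      ≤ cH d a * ∑ y ∈ T, |Bf y| * Real.exp (-(deltaH d a * dist y'' y)) := by
  have hN : (0 : ℝ) < ((n : ℝ) + 1) ^ d := by positivity
  set S := ∑ p ∈ B n y'', (∑ y ∈ T, kerH n a p y * Bf y) ^ 2 with hS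
  set W := ∑ y ∈ T, |Bf y| * Real.exp (-(deltaH d a * dist y'' y)) with hW
  have hW0 : 0 ≤ W := Finset.sum_nonneg fun y _ => by positivity
  have hA : 0 ≤ cH d a * Real.sqrt (((n : ℝ) + 1) ^ d) * W := by
    have := (cH_pos d ha).le; positivity
  -- the self-duality trick `S ≤ A·√S ⇒ √S ≤ A` (the tree's `Literature.MathematicalPhysics.QuantumLattice.sqrt_le_of_le_mul_sqrt`, inlined)
  have h0 := sum_sq_HB_le_mul_sqrt n ha y'' T Bf
  have h1 : Real.sqrt S ≤ cH d a * Real.sqrt (((n : ℝ) + 1) ^ d) * W := by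
    by_cases hS' : S ≤ 0
    · rw [Real.sqrt_eq_zero'.mpr hS']; exact hA
    · rw [not_le] at hS'
      have hsq : 0 < Real.sqrt S := Real.sqrt_pos.mpr hS'
      have : Real.sqrt S * Real.sqrt S ≤ cH d a * Real.sqrt (((n : ℝ) + 1) ^ d) * W * Real.sqrt S := by
        rw [Real.mul_self_sqrt hS'.le]; exact h0
      exact le_of_mul_le_mul_right this hsq
  rw [Real.sqrt_mul (inv_nonneg.mpr hN.le), Real.sqrt_inv]
  have hsq : 0 < Real.sqrt (((n : ℝ) + 1) ^ d) := Real.sqrt_pos.mpr hN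
  rw [inv_mul_le_iff₀ hsq]
  calc Real.sqrt S ≤ cH d a * Real.sqrt (((n : ℝ) + 1) ^ d) * W := h1
    _ = Real.sqrt (((n : ℝ) + 1) ^ d) * (cH d a * W) := by ring

/-! ## §3. The mixed letter, sup form -/

/-- **THE MIXED LETTER `‖H_M‖_{ℓ^∞ → ℓ^∞(blocks; RMS)} ≤ c_H(d,a)·K_d(δ_H(d,a))`, EVERY `d`, EVERY MESH**: for `0 ≤ R`, `|B(y)| ≤ R` on the
finite window `T`, and every block `y″`, `√((n+1)^{−d}Σ_{p∈B(y″)}(Σ_{y∈T}H(p,y)B(y))²) ≤ c_H·K_d(δ_H)·R` (`B4Sect5Proof.latticeSum_le`).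
By value the constant is the tree's `10^{366}` family — the SHAPE of F727 (d)'s letter, not its number. [folklore] -/
theorem blockRMS_HB_le_sup (n : ℕ) {a : ℝ} (ha : 0 < a) (y'' : X d) (T : Finset (X d)) (Bf : X d → ℝ) {R : ℝ}
    (hR : 0 ≤ R) (hB : ∀ y ∈ T, |Bf y| ≤ R) :
    Real.sqrt ((((n : ℝ) + 1) ^ d)⁻¹ * ∑ p ∈ B n y'', (∑ y ∈ T, kerH n a p y * Bf y) ^ 2)
      ≤ cH d a * latticeConst d (deltaH d a) * R := by
  refine (blockRMS_HB_le_weighted n ha y'' T Bf).trans ?_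
  have hδ := deltaH_pos d ha
  calc cH d a * ∑ y ∈ T, |Bf y| * Real.exp (-(deltaH d a * dist y'' y))
      ≤ cH d a * ∑ y ∈ T, R * Real.exp (-(deltaH d a * dist y'' y)) := by
        refine mul_le_mul_of_nonneg_left (Finset.sum_le_sum fun y hy => ?_) (cH_pos d ha).le
        exact mul_le_mul_of_nonneg_right (hB y hy) (Real.exp_pos _).le
    _ = cH d a * R * ∑ y ∈ T, Real.exp (-(deltaH d a * dist y'' y)) := by rw [← Finset.mul_sum]; ring
    _ ≤ cH d a * R * latticeConst d (deltaH d a) := by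
        refine mul_le_mul_of_nonneg_left (latticeSum_le d hδ T y'') ?_
        exact mul_nonneg (cH_pos d ha).le hR
    _ = cH d a * latticeConst d (deltaH d a) * R := by ring

/-! ## §4. The SDP-dual certificate shape -/

/-- weighted Cauchy–Schwarz: `(Σ_b x_b y_b)² ≤ (Σ_b w_b x_b²)·(Σ_b y_b²∕w_b)` for positive weights. [folklore] -/
theorem weighted_cauchy_schwarz {ι : Type*} (T : Finset ι) (w x y : ι → ℝ) (hw : ∀ b ∈ T, 0 < w b) :
    (∑ b ∈ T, x b * y b) ^ 2 ≤ (∑ b ∈ T, w b * x b ^ 2) * (∑ b ∈ T, y b ^ 2 / w b) := by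
  have h := Finset.sum_mul_sq_le_sq_mul_sq T (fun b => Real.sqrt (w b) * x b) (fun b => y b / Real.sqrt (w b))
  have e1 : ∑ b ∈ T, Real.sqrt (w b) * x b * (y b / Real.sqrt (w b)) = ∑ b ∈ T, x b * y b := by
    refine Finset.sum_congr rfl fun b hb => ?_
    have hs : Real.sqrt (w b) ≠ 0 := (Real.sqrt_pos.mpr (hw b hb)).ne'
    field_simp
  have e2 : ∑ b ∈ T, (Real.sqrt (w b) * x b) ^ 2 = ∑ b ∈ T, w b * x b ^ 2 := by
    refine Finset.sum_congr rfl fun b hb => ?_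
    rw [mul_pow, Real.sq_sqrt (hw b hb).le]
  have e3 : ∑ b ∈ T, (y b / Real.sqrt (w b)) ^ 2 = ∑ b ∈ T, y b ^ 2 / w b := by
    refine Finset.sum_congr rfl fun b hb => ?_
    rw [div_pow, Real.sq_sqrt (hw b hb).le]
  rw [e1, e2, e3] at h
  exact h

/-- **THE SDP-DUAL CERTIFICATE SHAPE (F727 (d) U2) AS A THEOREM**: for finite index sets `Z` (a block) and `T` (a coarse window), any kernel
`h : Z → T → ℝ`, weights `w_b > 0` on `T` and `λ`: if `Σ_{b∈T}(Σ_{z∈Z}v_z h_{zb})²∕w_b ≤ λ·Σ_{z∈Z}v_z²` for EVERY test vector `v` (i.e.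
`Σ_b h(b)h(b)ᵀ∕w_b ⪯ λ·1`, one top eigenvalue), then `Σ_{z∈Z}(Σ_{b∈T}h_{zb}B_b)² ≤ λ·Σ_{b∈T}w_bB_b²` for EVERY `B` (weighted Cauchy–Schwarz with
`v := hB`, then the self-duality trick). [folklore] -/
theorem sdpDual_certificate {ζ ι : Type*} (Z : Finset ζ) (T : Finset ι) (h : ζ → ι → ℝ) (w : ι → ℝ) (lam : ℝ)
    (hw : ∀ b ∈ T, 0 < w b) (hlam : 0 ≤ lam)
    (hdual : ∀ v : ζ → ℝ, ∑ b ∈ T, (∑ z ∈ Z, v z * h z b) ^ 2 / w b ≤ lam * ∑ z ∈ Z, v z ^ 2) (Bf : ι → ℝ) :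
    ∑ z ∈ Z, (∑ b ∈ T, h z b * Bf b) ^ 2 ≤ lam * ∑ b ∈ T, w b * Bf b ^ 2 := by
  set F : ζ → ℝ := fun z => ∑ b ∈ T, h z b * Bf b with hF
  set S := ∑ z ∈ Z, F z ^ 2 with hS
  have hS0 : 0 ≤ S := Finset.sum_nonneg fun _ _ => sq_nonneg _
  have hWB : 0 ≤ ∑ b ∈ T, w b * Bf b ^ 2 := Finset.sum_nonneg fun b hb => mul_nonneg (hw b hb).le (sq_nonneg _)
  -- `S = Σ_b B_b (Σ_z F_z h_{zb})`
  have hswap : S = ∑ b ∈ T, Bf b * ∑ z ∈ Z, F z * h z b := by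
    calc S = ∑ z ∈ Z, ∑ b ∈ T, F z * (h z b * Bf b) := by
          refine Finset.sum_congr rfl fun z _ => ?_
          rw [sq, hF, Finset.mul_sum]
      _ = ∑ b ∈ T, ∑ z ∈ Z, F z * (h z b * Bf b) := Finset.sum_comm
      _ = ∑ b ∈ T, Bf b * ∑ z ∈ Z, F z * h z b := by
          refine Finset.sum_congr rfl fun b _ => ?_
          rw [Finset.mul_sum]
          exact Finset.sum_congr rfl fun z _ => by ring
  -- weighted Cauchy–Schwarz and the dual hypothesis at `v := F`
  have hcs := weighted_cauchy_schwarz T w Bf (fun b => ∑ z ∈ Z, F z * h z b) hw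
  beta_reduce at hcs
  have hd := hdual F
  have hS2 : S ^ 2 ≤ (∑ b ∈ T, w b * Bf b ^ 2) * (lam * S) := by
    have h' := hcs.trans (mul_le_mul_of_nonneg_left hd hWB)
    rwa [← hswap] at h'
  -- `S² ≤ (λ Σ wB²)·S` ⇒ `S ≤ λ Σ wB²`
  by_cases hS' : S = 0
  · rw [hS']; positivity
  · have hSpos : 0 < S := lt_of_le_of_ne hS0 (Ne.symm hS')
    have : S * S ≤ (lam * ∑ b ∈ T, w b * Bf b ^ 2) * S := by rw [← sq]; linarith [hS2]
    exact le_of_mul_le_mul_right this hSpos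

/-! ## §5. The certificate read on the one-shot section -/

/-- **THE CERTIFICATE ON `H`**: on the block `B(y″)` and a finite coarse window `T`, a dual certificate `(w, λ)` for the matrix
`(H(p,y))_{p∈B(y″), y∈T}` gives `Σ_{p∈B(y″)}(Σ_{y∈T}H(p,y)B(y))² ≤ λ·Σ_{y∈T}w_yB(y)²` for every `B`. [folklore] -/
theorem sdpDual_certificate_kerH (n : ℕ) (a : ℝ) (y'' : X d) (T : Finset (X d)) (w : X d → ℝ) (lam : ℝ)
    (hw : ∀ y ∈ T, 0 < w y) (hlam : 0 ≤ lam)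
    (hdual : ∀ v : X d → ℝ, ∑ y ∈ T, (∑ p ∈ B n y'', v p * kerH n a p y) ^ 2 / w y ≤ lam * ∑ p ∈ B n y'', v p ^ 2)
    (Bf : X d → ℝ) :
    ∑ p ∈ B n y'', (∑ y ∈ T, kerH n a p y * Bf y) ^ 2 ≤ lam * ∑ y ∈ T, w y * Bf y ^ 2 :=
  sdpDual_certificate (B n y'') T (fun p y => kerH n a p y) w lam hw hlam hdual Bf

/-- **F727 (d)'s `K_mix² ≤ λ·(Σw)∕M^d`, VERBATIM**: with a dual certificate `(w, λ)` and `|B| ≤ R` on `T` (`0 ≤ R`),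
`√((n+1)^{−d}Σ_{p∈B(y″)}(Σ_{y∈T}H(p,y)B(y))²) ≤ √(λ·(Σ_{y∈T}w_y)∕(n+1)^d)·R` — the receptacle for a certified `(w, λ)` at fixed
`(d, M, R)`. [folklore] -/
theorem blockRMS_HB_le_of_certificate (n : ℕ) (a : ℝ) (y'' : X d) (T : Finset (X d)) (w : X d → ℝ) (lam : ℝ)
    (hw : ∀ y ∈ T, 0 < w y) (hlam : 0 ≤ lam)
    (hdual : ∀ v : X d → ℝ, ∑ y ∈ T, (∑ p ∈ B n y'', v p * kerH n a p y) ^ 2 / w y ≤ lam * ∑ p ∈ B n y'', v p ^ 2)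
    (Bf : X d → ℝ) {R : ℝ} (hR : 0 ≤ R) (hB : ∀ y ∈ T, |Bf y| ≤ R) :
    Real.sqrt ((((n : ℝ) + 1) ^ d)⁻¹ * ∑ p ∈ B n y'', (∑ y ∈ T, kerH n a p y * Bf y) ^ 2)
      ≤ Real.sqrt (lam * (∑ y ∈ T, w y) / ((n : ℝ) + 1) ^ d) * R := by
  have hN : (0 : ℝ) < ((n : ℝ) + 1) ^ d := by positivity
  have h1 := sdpDual_certificate_kerH n a y'' T w lam hw hlam hdual Bf
  have h2 : ∑ y ∈ T, w y * Bf y ^ 2 ≤ (∑ y ∈ T, w y) * R ^ 2 := by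
    rw [Finset.sum_mul]
    refine Finset.sum_le_sum fun y hy => mul_le_mul_of_nonneg_left ?_ (hw y hy).le
    have := hB y hy
    rw [← sq_abs]
    exact pow_le_pow_left₀ (abs_nonneg _) this 2
  have h3 : (((n : ℝ) + 1) ^ d)⁻¹ * ∑ p ∈ B n y'', (∑ y ∈ T, kerH n a p y * Bf y) ^ 2
      ≤ (lam * (∑ y ∈ T, w y) / ((n : ℝ) + 1) ^ d) * R ^ 2 := by
    rw [div_mul_eq_mul_div, inv_mul_eq_div, div_le_div_iff_of_pos_right hN]
    calc ∑ p ∈ B n y'', (∑ y ∈ T, kerH n a p y * Bf y) ^ 2 ≤ lam * ∑ y ∈ T, w y * Bf y ^ 2 := h1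
      _ ≤ lam * ((∑ y ∈ T, w y) * R ^ 2) := mul_le_mul_of_nonneg_left h2 hlam
      _ = lam * (∑ y ∈ T, w y) * R ^ 2 := by ring
  calc Real.sqrt ((((n : ℝ) + 1) ^ d)⁻¹ * ∑ p ∈ B n y'', (∑ y ∈ T, kerH n a p y * Bf y) ^ 2)
      ≤ Real.sqrt ((lam * (∑ y ∈ T, w y) / ((n : ℝ) + 1) ^ d) * R ^ 2) := Real.sqrt_le_sqrt h3
    _ = Real.sqrt (lam * (∑ y ∈ T, w y) / ((n : ℝ) + 1) ^ d) * R := by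
        rw [Real.sqrt_mul' _ (sq_nonneg R), Real.sqrt_sq hR]

end Summit.QuantumFields.BalabanUV.T4Continuum.NE7b.OneShotChartMixedNorm
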